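import Mathlib.Topology.CWComplex.Classical.Finite
import Mathlib.Analysis.Normed.Module.Basic
import Mathlib.Topology.MetricSpace.Thickening
import Mathlib.Topology.MetricSpace.ProperSpace.Lemmas
import Mathlib.Algebra.Order.Floor.Defs
import Mathlib.Data.Finset.Sort
import HarnessLib

/-!
# Lattice cube complexes in `ℝᴺ` are finite CW complexes; cubical neighbourhoods of compact sets

Topic `Literature/Topology/Euclidean`. Elementary material absent from Mathlib, which has classical
CW complexes (`Topology.CWComplex`, with the relaxed constructor `Topology.CWComplex.mkFinite`
for finite complexes) but no examples beyond graphs: the finite unions of cubes of the lattice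
`h ℤᴺ ⊆ ℝᴺ` and their natural cell structure by (relatively open) faces.

* `Literature.Topology.Euclidean.LatticeCube.Face N`: a face of the cubical lattice of mesh `h`
  in `ℝᴺ = Fin N → ℝ` (sup norm), given by its lower corner `a ∈ ℤᴺ` and the set `S` of its free
  directions: `F(a, S) = {x | xᵢ ∈ [aᵢ h, (aᵢ + 1) h] (i ∈ S), xᵢ = aᵢ h (i ∉ S)}`, of dimension
  `|S|`; its relative interior `relint`; the affine characteristic map `param` from the cube
  `[-1, 1]^{|S|}` (the closed unit ball of `Fin |S| → ℝ`) onto `F(a, S)`, a homeomorphism of the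
  open ball onto `relint F(a, S)` with inverse `coord`.
* `Literature.Topology.Euclidean.LatticeCube.complex h 𝒬`: the union `K` of the top-dimensional
  cubes `F(b, univ)`, `b ∈ 𝒬` (`𝒬 ⊆ ℤᴺ` finite), and
  `Literature.Topology.Euclidean.LatticeCube.cwComplex h 𝒬 : Topology.CWComplex (univ : Set ↥K)`:
  **a finite lattice cube complex is a finite CW complex** whose cells are the faces of the
  cubes of `𝒬` (relative interiors of distinct faces are disjoint; the boundary of a `k`-face is a
  union of `(k-1)`-faces; the closed faces cover `K`).
* `Literature.Topology.Euclidean.exists_cwComplex_nbhd_of_isCompact`: **every compact subset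
  `S` of an open set `O ⊆ ℝᴺ` lies in a compact set `K`, `S ⊆ K ⊆ O`, carrying a finite CW
  structure** — the union of the lattice cubes of small mesh meeting `S`.

This is the standard device by which compact subsets of Euclidean space (compact manifolds,
compact Euclidean neighbourhood retracts) are dominated by finite CW complexes (Hatcher,
*Algebraic Topology* (2002), Appendix, Cor. A.9–Prop. A.11 and the proof of Thm. A.7: "choose a
small cubical neighbourhood"); it is used in `Literature/Topology/FourManifolds/` to apply
Whitehead's theorem to punctured homotopy spheres (Kervaire–Milnor 1963, Lemma 2.4) without a CW
structure on the manifold. Everything here is proved; there are no named facts.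

## References

* A. Hatcher, *Algebraic Topology*, CUP (2002), Appendix: CW structures on cubes, Prop. A.11,
  Cor. A.12. [HatcherAT2002]
-/

noncomputable section

open Set Metric Topology Function

namespace Literature.Topology.Euclidean

namespace LatticeCube

variable {N : ℕ}

/-! ### Faces of the cubical lattice -/

variable (N) in
/-- A face of the cubical lattice `h ℤᴺ`: lower corner `a ∈ ℤᴺ` and set `S` of free coordinate
directions; it stands for `F(a, S) = {x | xᵢ ∈ [aᵢ h, (aᵢ + 1) h] for i ∈ S, xᵢ = aᵢ h for i ∉ S}`
(`carrier`). [folklore] -/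
@[ext]
structure Face where
  /-- the lower corner, in lattice units -/
  a : Fin N → ℤ
  /-- the free directions -/
  S : Finset (Fin N)

namespace Face

variable (h : ℝ) (F : Face N)

/-- The closed face `F(a, S) ⊆ ℝᴺ`. [folklore] -/
def carrier : Set (Fin N → ℝ) :=
  {x | ∀ i, (i ∈ F.S → (F.a i : ℝ) * h ≤ x i ∧ x i ≤ ((F.a i : ℝ) + 1) * h) ∧
    (i ∉ F.S → x i = (F.a i : ℝ) * h)}

/-- The relative interior of the face: strict inequalities in the free directions. [folklore] -/
def relint : Set (Fin N → ℝ) :=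
  {x | ∀ i, (i ∈ F.S → (F.a i : ℝ) * h < x i ∧ x i < ((F.a i : ℝ) + 1) * h) ∧
    (i ∉ F.S → x i = (F.a i : ℝ) * h)}

variable {h F}

/-- Unfolding of `carrier`. [folklore] -/
theorem mem_carrier {x : Fin N → ℝ} : x ∈ F.carrier h ↔
    ∀ i, (i ∈ F.S → (F.a i : ℝ) * h ≤ x i ∧ x i ≤ ((F.a i : ℝ) + 1) * h) ∧
      (i ∉ F.S → x i = (F.a i : ℝ) * h) := Iff.rfl

/-- Unfolding of `relint`. [folklore] -/
theorem mem_relint {x : Fin N → ℝ} : x ∈ F.relint h ↔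
    ∀ i, (i ∈ F.S → (F.a i : ℝ) * h < x i ∧ x i < ((F.a i : ℝ) + 1) * h) ∧
      (i ∉ F.S → x i = (F.a i : ℝ) * h) := Iff.rfl

/-- The relative interior lies in the closed face. [folklore] -/
theorem relint_subset_carrier : F.relint h ⊆ F.carrier h := fun _ hx i =>
  ⟨fun hi => ⟨((hx i).1 hi).1.le, ((hx i).1 hi).2.le⟩, fun hi => (hx i).2 hi⟩

/-- `F` is a face of the top cube with lower corner `b`: the free coordinates of `F` start at
`bᵢ`, the frozen ones sit at `bᵢ` or `bᵢ + 1`. [folklore] -/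
def IsFaceOf (F : Face N) (b : Fin N → ℤ) : Prop :=
  ∀ i, (i ∈ F.S → F.a i = b i) ∧ (i ∉ F.S → F.a i = b i ∨ F.a i = b i + 1)

variable (N) in
/-- The top cube with lower corner `b`, as a face (all directions free). [folklore] -/
def top (b : Fin N → ℤ) : Face N := ⟨b, Finset.univ⟩

/-- The lower corner of a top cube. [folklore] -/
@[simp] theorem top_a (b : Fin N → ℤ) : (top N b).a = b := rfl
/-- All directions of a top cube are free. [folklore] -/
@[simp] theorem top_S (b : Fin N → ℤ) : (top N b).S = Finset.univ := rfl

/-- A top cube is a face of itself. [folklore] -/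
theorem top_isFaceOf (b : Fin N → ℤ) : (top N b).IsFaceOf b :=
  fun i => ⟨fun _ => rfl, fun hi => absurd (Finset.mem_univ i) hi⟩

/-- Membership in a top cube. [folklore] -/
theorem mem_carrier_top {b : Fin N → ℤ} {x : Fin N → ℝ} :
    x ∈ (top N b).carrier h ↔ ∀ i, (b i : ℝ) * h ≤ x i ∧ x i ≤ ((b i : ℝ) + 1) * h := by
  simp [mem_carrier]

/-- A face of the cube `b` lies in the cube `b` (for `h ≥ 0`). [folklore] -/
theorem carrier_subset_carrier_top (hh : 0 ≤ h) {b : Fin N → ℤ} (hF : F.IsFaceOf b) :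
    F.carrier h ⊆ (top N b).carrier h := by
  intro x hx
  rw [mem_carrier_top]
  intro i
  by_cases hi : i ∈ F.S
  · have h1 := (hx i).1 hi
    rw [(hF i).1 hi] at h1
    exact h1
  · have h1 := (hx i).2 hi
    rcases (hF i).2 hi with h2 | h2
    · rw [h1, h2]; constructor <;> nlinarith
    · rw [h1, h2]; push_cast; constructor <;> nlinarith

/-! ### The characteristic map of a face -/

section Param

variable (h F)
variable {k : ℕ} (hk : F.S.card = k)

/-- The clamped affine reparametrisation `[-1, 1] → [0, 1]`, `u ↦ (u + 1) / 2`, extended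
constantly outside (so that the characteristic map is defined and continuous on all of
`Fin k → ℝ` and always lands in the face). [folklore] -/
def unitClamp (u : ℝ) : ℝ := max 0 (min 1 ((u + 1) / 2))

/-- `unitClamp ≥ 0`. [folklore] -/
theorem unitClamp_nonneg (u : ℝ) : 0 ≤ unitClamp u := le_max_left _ _

/-- `unitClamp ≤ 1`. [folklore] -/
theorem unitClamp_le_one (u : ℝ) : unitClamp u ≤ 1 :=
  max_le zero_le_one (min_le_left _ _)

/-- On `[-1, 1]` the clamp is inactive. [folklore] -/
theorem unitClamp_of_abs_le {u : ℝ} (hu : |u| ≤ 1) : unitClamp u = (u + 1) / 2 := by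
  rw [abs_le] at hu
  unfold unitClamp
  rw [min_eq_right (by linarith), max_eq_right (by linarith)]

/-- On `(-1, 1)` the clamp is positive. [folklore] -/
theorem unitClamp_pos_of_abs_lt {u : ℝ} (hu : |u| < 1) : 0 < unitClamp u := by
  rw [unitClamp_of_abs_le hu.le]; rw [abs_lt] at hu; linarith

/-- On `(-1, 1)` the clamp is `< 1`. [folklore] -/
theorem unitClamp_lt_one_of_abs_lt {u : ℝ} (hu : |u| < 1) : unitClamp u < 1 := by
  rw [unitClamp_of_abs_le hu.le]; rw [abs_lt] at hu; linarith

/-- The clamp is continuous. [folklore] -/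
@[fun_prop]
theorem continuous_unitClamp : Continuous unitClamp := by
  unfold unitClamp; fun_prop

/-- The characteristic map of the face `F` (with `|S| = k`): the `j`-th cube coordinate drives
the `j`-th free direction of `F` (in increasing order), frozen directions stay at `aᵢ h`.
[folklore] -/
def param (y : Fin k → ℝ) : Fin N → ℝ := fun i =>
  if hi : i ∈ F.S then (F.a i : ℝ) * h + h * unitClamp (y ((F.S.orderIsoOfFin hk).symm ⟨i, hi⟩))
  else (F.a i : ℝ) * h

/-- The inverse chart: cube coordinates of a point of the face. [folklore] -/
def coord (x : Fin N → ℝ) : Fin k → ℝ := fun j =>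
  2 * ((x (F.S.orderIsoOfFin hk j) - (F.a (F.S.orderIsoOfFin hk j) : ℝ) * h) / h) - 1

variable {h F hk}

/-- The characteristic map in a free direction. [folklore] -/
theorem param_apply_of_mem (y : Fin k → ℝ) {i : Fin N} (hi : i ∈ F.S) :
    F.param h hk y i = (F.a i : ℝ) * h + h * unitClamp (y ((F.S.orderIsoOfFin hk).symm ⟨i, hi⟩)) := by
  simp [param, hi]

/-- The characteristic map in a frozen direction. [folklore] -/
theorem param_apply_of_not_mem (y : Fin k → ℝ) {i : Fin N} (hi : i ∉ F.S) :
    F.param h hk y i = (F.a i : ℝ) * h := by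
  simp [param, hi]

/-- The characteristic map in the `j`-th free direction. [folklore] -/
theorem param_apply_orderIso (y : Fin k → ℝ) (j : Fin k) :
    F.param h hk y (F.S.orderIsoOfFin hk j) =
      (F.a (F.S.orderIsoOfFin hk j) : ℝ) * h + h * unitClamp (y j) := by
  rw [param_apply_of_mem y (F.S.orderIsoOfFin hk j).2]
  have hj : (F.S.orderIsoOfFin hk).symm ⟨(F.S.orderIsoOfFin hk j : Fin N),
      (F.S.orderIsoOfFin hk j).2⟩ = j := by
    rw [Subtype.coe_eta]; exact OrderIso.symm_apply_apply _ _
  rw [hj]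

/-- The characteristic map is continuous. [folklore] -/
@[fun_prop]
theorem continuous_param : Continuous (F.param h hk) := by
  refine continuous_pi fun i => ?_
  by_cases hi : i ∈ F.S
  · simp only [param, hi, dite_true]
    fun_prop
  · simp only [param, hi, dite_false]
    exact continuous_const

/-- The inverse chart is continuous. [folklore] -/
@[fun_prop]
theorem continuous_coord : Continuous (F.coord h hk) := by
  unfold coord; fun_prop

/-- The characteristic map lands in the closed face (for `h > 0`), whatever the argument.
[folklore] -/
theorem param_mem_carrier (hh : 0 < h) (y : Fin k → ℝ) : F.param h hk y ∈ F.carrier h := by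
  intro i
  constructor
  · intro hi
    rw [param_apply_of_mem y hi]
    have h0 := unitClamp_nonneg (y ((F.S.orderIsoOfFin hk).symm ⟨i, hi⟩))
    have h1 := unitClamp_le_one (y ((F.S.orderIsoOfFin hk).symm ⟨i, hi⟩))
    constructor <;> nlinarith
  · intro hi
    rw [param_apply_of_not_mem y hi]

/-- On the open cube the characteristic map lands in the relative interior. [folklore] -/
theorem param_mem_relint (hh : 0 < h) {y : Fin k → ℝ} (hy : y ∈ ball (0 : Fin k → ℝ) 1) :
    F.param h hk y ∈ F.relint h := by
  rw [mem_ball_zero_iff, pi_norm_lt_iff one_pos] at hy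
  intro i
  constructor
  · intro hi
    rw [param_apply_of_mem y hi]
    have hyj := hy ((F.S.orderIsoOfFin hk).symm ⟨i, hi⟩)
    rw [Real.norm_eq_abs] at hyj
    have h0 := unitClamp_pos_of_abs_lt hyj
    have h1 := unitClamp_lt_one_of_abs_lt hyj
    constructor <;> nlinarith
  · intro hi
    rw [param_apply_of_not_mem y hi]

/-- `coord` is a left inverse of `param` on the closed cube. [folklore] -/
theorem coord_param (hh : 0 < h) {y : Fin k → ℝ} (hy : y ∈ closedBall (0 : Fin k → ℝ) 1) :
    F.coord h hk (F.param h hk y) = y := by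
  rw [mem_closedBall_zero_iff, pi_norm_le_iff_of_nonneg zero_le_one] at hy
  funext j
  have hyj := hy j
  rw [Real.norm_eq_abs] at hyj
  simp only [coord, param_apply_orderIso, unitClamp_of_abs_le hyj]
  field_simp
  ring

/-- `param` is a right inverse of `coord` on the closed face. [folklore] -/
theorem param_coord (hh : 0 < h) {x : Fin N → ℝ} (hx : x ∈ F.carrier h) :
    F.param h hk (F.coord h hk x) = x := by
  funext i
  by_cases hi : i ∈ F.S
  · rw [param_apply_of_mem _ hi]
    have hx1 := (hx i).1 hi
    set j := (F.S.orderIsoOfFin hk).symm ⟨i, hi⟩ with hj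
    have hji : ((F.S.orderIsoOfFin hk j : F.S) : Fin N) = i := by
      rw [hj, OrderIso.apply_symm_apply]
    have hc : F.coord h hk x j = 2 * ((x i - (F.a i : ℝ) * h) / h) - 1 := by
      simp only [coord, hji]
    have habs : |F.coord h hk x j| ≤ 1 := by
      rw [hc, abs_le]
      constructor
      · have : 0 ≤ (x i - (F.a i : ℝ) * h) / h := div_nonneg (by linarith [hx1.1]) hh.le
        linarith
      · have : (x i - (F.a i : ℝ) * h) / h ≤ 1 := by
          rw [div_le_one hh]; linarith [hx1.2]
        linarith
    rw [unitClamp_of_abs_le habs, hc]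
    field_simp
    ring
  · rw [param_apply_of_not_mem _ hi, (hx i).2 hi]

/-- `coord` maps the relative interior into the open cube. [folklore] -/
theorem coord_mem_ball (hh : 0 < h) {x : Fin N → ℝ} (hx : x ∈ F.relint h) :
    F.coord h hk x ∈ ball (0 : Fin k → ℝ) 1 := by
  rw [mem_ball_zero_iff, pi_norm_lt_iff one_pos]
  intro j
  rw [Real.norm_eq_abs, abs_lt]
  have hmem := (F.S.orderIsoOfFin hk j).2
  have hx1 := (hx _).1 hmem
  simp only [coord]
  constructor
  · have : 0 < (x (F.S.orderIsoOfFin hk j) - (F.a (F.S.orderIsoOfFin hk j) : ℝ) * h) / h :=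
      div_pos (by linarith [hx1.1]) hh
    linarith
  · have : (x (F.S.orderIsoOfFin hk j) - (F.a (F.S.orderIsoOfFin hk j) : ℝ) * h) / h < 1 := by
      rw [div_lt_one hh]; linarith [hx1.2]
    linarith

/-- `coord` maps the closed face into the closed cube. [folklore] -/
theorem coord_mem_closedBall (hh : 0 < h) {x : Fin N → ℝ} (hx : x ∈ F.carrier h) :
    F.coord h hk x ∈ closedBall (0 : Fin k → ℝ) 1 := by
  rw [mem_closedBall_zero_iff, pi_norm_le_iff_of_nonneg zero_le_one]
  intro j
  rw [Real.norm_eq_abs, abs_le]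
  have hmem := (F.S.orderIsoOfFin hk j).2
  have hx1 := (hx _).1 hmem
  simp only [coord]
  constructor
  · have : 0 ≤ (x (F.S.orderIsoOfFin hk j) - (F.a (F.S.orderIsoOfFin hk j) : ℝ) * h) / h :=
      div_nonneg (by linarith [hx1.1]) hh.le
    linarith
  · have : (x (F.S.orderIsoOfFin hk j) - (F.a (F.S.orderIsoOfFin hk j) : ℝ) * h) / h ≤ 1 := by
      rw [div_le_one hh]; linarith [hx1.2]
    linarith

/-- The closed face is the image of the closed cube. [folklore] -/
theorem image_param_closedBall (hh : 0 < h) :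
    F.param h hk '' closedBall (0 : Fin k → ℝ) 1 = F.carrier h := by
  refine Subset.antisymm ?_ ?_
  · rintro _ ⟨y, -, rfl⟩
    exact param_mem_carrier hh y
  · intro x hx
    exact ⟨F.coord h hk x, coord_mem_closedBall hh hx, param_coord hh hx⟩

/-- The relative interior is the image of the open cube. [folklore] -/
theorem image_param_ball (hh : 0 < h) :
    F.param h hk '' ball (0 : Fin k → ℝ) 1 = F.relint h := by
  refine Subset.antisymm ?_ ?_
  · rintro _ ⟨y, hy, rfl⟩
    exact param_mem_relint hh hy
  · intro x hx
    exact ⟨F.coord h hk x, coord_mem_ball hh hx, param_coord hh (relint_subset_carrier hx)⟩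

end Param

/-! ### Distinct faces have disjoint relative interiors -/

/-- A point of the relative interior of a face determines the face (for `h > 0`): relative
interiors of distinct faces of the lattice are disjoint. [folklore] -/
theorem eq_of_mem_relint (hh : 0 < h) {F G : Face N} {x : Fin N → ℝ} (hF : x ∈ F.relint h)
    (hG : x ∈ G.relint h) : F = G := by
  -- integer bounds extracted from the real inequalities
  have key : ∀ {a b : ℤ} {t : ℝ}, (a : ℝ) * h < t → t < ((a : ℝ) + 1) * h → t = (b : ℝ) * h →
      False := by
    intro a b t h1 h2 h3
    rw [h3] at h1 h2
    have h1' : (a : ℝ) < b := lt_of_mul_lt_mul_right h1 hh.le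
    have h2' : (b : ℝ) < a + 1 := lt_of_mul_lt_mul_right h2 hh.le
    have h1'' : a < b := by exact_mod_cast h1'
    have h2'' : b < a + 1 := by exact_mod_cast h2'
    omega
  have hS : ∀ i, i ∈ F.S ↔ i ∈ G.S := fun i => by
    constructor
    · intro hi
      by_contra hi'
      exact key ((hF i).1 hi).1 ((hF i).1 hi).2 ((hG i).2 hi')
    · intro hi
      by_contra hi'
      exact key ((hG i).1 hi).1 ((hG i).1 hi).2 ((hF i).2 hi')
  have ha : ∀ i, F.a i = G.a i := fun i => by
    by_cases hi : i ∈ F.S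
    · have hi' := (hS i).1 hi
      have h1 := (hF i).1 hi
      have h2 := (hG i).1 hi'
      have e1 : ⌊x i / h⌋ = F.a i := by
        rw [Int.floor_eq_iff, le_div_iff₀ hh, div_lt_iff₀ hh]
        exact ⟨h1.1.le, h1.2⟩
      have e2 : ⌊x i / h⌋ = G.a i := by
        rw [Int.floor_eq_iff, le_div_iff₀ hh, div_lt_iff₀ hh]
        exact ⟨h2.1.le, h2.2⟩
      rw [← e1, ← e2]
    · have hi' : i ∉ G.S := fun h' => hi ((hS i).2 h')
      have h1 := (hF i).2 hi
      have h2 := (hG i).2 hi'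
      rw [h1] at h2
      have h3 : (F.a i : ℝ) = G.a i := mul_right_cancel₀ hh.ne' h2
      exact_mod_cast h3
  ext i
  · exact ha i
  · exact hS i

/-! ### Boundary faces -/

/-- The face of `F` obtained by freezing the free direction `i₀` at its lower (`up = false`)
or upper (`up = true`) end. [folklore] -/
def bdFace (F : Face N) (i₀ : Fin N) (up : Bool) : Face N :=
  ⟨if up then Function.update F.a i₀ (F.a i₀ + 1) else F.a, F.S.erase i₀⟩

/-- The free directions of a boundary face. [folklore] -/
theorem bdFace_S (F : Face N) (i₀ : Fin N) (up : Bool) : (F.bdFace i₀ up).S = F.S.erase i₀ := rfl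

/-- The corner of a boundary face away from the frozen direction. [folklore] -/
theorem bdFace_a_of_ne (F : Face N) {i₀ i : Fin N} (up : Bool) (hi : i ≠ i₀) :
    (F.bdFace i₀ up).a i = F.a i := by
  unfold bdFace
  cases up
  · rfl
  · simp [Function.update_of_ne hi]

/-- The corner of the upper boundary face in the frozen direction. [folklore] -/
theorem bdFace_a_self_true (F : Face N) (i₀ : Fin N) : (F.bdFace i₀ true).a i₀ = F.a i₀ + 1 := by
  simp [bdFace]

/-- The corner of the lower boundary face in the frozen direction. [folklore] -/
theorem bdFace_a_self_false (F : Face N) (i₀ : Fin N) : (F.bdFace i₀ false).a i₀ = F.a i₀ := by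
  simp [bdFace]

/-- Boundary faces of a face of the cube `b` are faces of the cube `b`. [folklore] -/
theorem bdFace_isFaceOf {F : Face N} {b : Fin N → ℤ} (hF : F.IsFaceOf b) {i₀ : Fin N}
    (hi₀ : i₀ ∈ F.S) (up : Bool) : (F.bdFace i₀ up).IsFaceOf b := by
  intro i
  constructor
  · intro hi
    rw [bdFace_S, Finset.mem_erase] at hi
    rw [bdFace_a_of_ne F up hi.1]
    exact (hF i).1 hi.2
  · intro hi
    rw [bdFace_S, Finset.mem_erase, not_and] at hi
    by_cases hii : i = i₀
    · subst hii
      have h0 : F.a i = b i := (hF i).1 hi₀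
      cases up
      · left; rw [bdFace_a_self_false, h0]
      · right; rw [bdFace_a_self_true, h0]
    · rw [bdFace_a_of_ne F up hii]
      exact (hF i).2 (fun h' => hi hii h')

/-- A boundary face has one free direction less. [folklore] -/
theorem card_bdFace_S {F : Face N} {i₀ : Fin N} (hi₀ : i₀ ∈ F.S) (up : Bool) :
    (F.bdFace i₀ up).S.card = F.S.card - 1 := by
  rw [bdFace_S, Finset.card_erase_of_mem hi₀]

/-- A point of the characteristic cube with `j₀`-th coordinate `+1` is mapped into the upper
boundary face in the corresponding direction. [folklore] -/
theorem param_mem_carrier_bdFace_true (hh : 0 < h) {k : ℕ} {hk : F.S.card = k} {y : Fin k → ℝ}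
    {j₀ : Fin k} (hy : y j₀ = 1) :
    F.param h hk y ∈ (F.bdFace (F.S.orderIsoOfFin hk j₀) true).carrier h := by
  have hy0 := param_mem_carrier (F := F) (hk := hk) hh y
  intro i
  by_cases hii : i = (F.S.orderIsoOfFin hk j₀ : Fin N)
  · subst hii
    constructor
    · intro hi
      rw [bdFace_S, Finset.mem_erase] at hi
      exact absurd rfl hi.1
    · intro _
      rw [bdFace_a_self_true, param_apply_orderIso, hy, unitClamp_of_abs_le (by simp)]
      push_cast
      ring
  · rw [bdFace_a_of_ne F true hii, bdFace_S, Finset.mem_erase]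
    constructor
    · intro hi
      exact (hy0 i).1 hi.2
    · intro hi
      rw [not_and] at hi
      exact (hy0 i).2 (hi hii)

/-- A point of the characteristic cube with `j₀`-th coordinate `-1` is mapped into the lower
boundary face in the corresponding direction. [folklore] -/
theorem param_mem_carrier_bdFace_false (hh : 0 < h) {k : ℕ} {hk : F.S.card = k} {y : Fin k → ℝ}
    {j₀ : Fin k} (hy : y j₀ = -1) :
    F.param h hk y ∈ (F.bdFace (F.S.orderIsoOfFin hk j₀) false).carrier h := by
  have hy0 := param_mem_carrier (F := F) (hk := hk) hh y
  intro i
  by_cases hii : i = (F.S.orderIsoOfFin hk j₀ : Fin N)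
  · subst hii
    constructor
    · intro hi
      rw [bdFace_S, Finset.mem_erase] at hi
      exact absurd rfl hi.1
    · intro _
      rw [bdFace_a_self_false, param_apply_orderIso, hy, unitClamp_of_abs_le (by simp)]
      ring
  · rw [bdFace_a_of_ne F false hii, bdFace_S, Finset.mem_erase]
    constructor
    · intro hi
      exact (hy0 i).1 hi.2
    · intro hi
      rw [not_and] at hi
      exact (hy0 i).2 (hi hii)

/-- A point of the unit sphere of `Fin k → ℝ` (sup norm) has a coordinate equal to `±1`.
[folklore] -/
theorem exists_abs_eq_one_of_mem_sphere {k : ℕ} {y : Fin k → ℝ} (hy : y ∈ sphere (0 : Fin k → ℝ) 1) :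
    ∃ j, y j = 1 ∨ y j = -1 := by
  have hy1 : ‖y‖ = 1 := mem_sphere_zero_iff_norm.1 hy
  have hm : Nonempty (Fin k) := by
    by_contra hcon
    rw [not_nonempty_iff] at hcon
    have : y = 0 := Subsingleton.elim _ _
    rw [this, norm_zero] at hy1
    exact zero_ne_one hy1
  obtain ⟨j, -, hj⟩ := Finset.exists_mem_eq_sup (Finset.univ : Finset (Fin k))
    Finset.univ_nonempty (fun j => ‖y j‖₊)
  have hnorm : ‖y‖ = ‖y j‖ := by
    rw [Pi.norm_def]
    exact congrArg NNReal.toReal hj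
  rw [hy1, Real.norm_eq_abs] at hnorm
  refine ⟨j, ?_⟩
  rcases (abs_eq zero_le_one).1 hnorm.symm with h1 | h1
  · exact Or.inl h1
  · exact Or.inr h1

end Face

/-! ### Finite cube complexes -/

variable (𝒬 : Finset (Fin N → ℤ))

/-- The faces of the cubes of `𝒬`. [folklore] -/
def faces : Set (Face N) := {F | ∃ b ∈ 𝒬, F.IsFaceOf b}

/-- Each cube has finitely many faces, so `faces 𝒬` is finite. [folklore] -/
theorem faces_finite : (faces 𝒬).Finite := by
  classical
  have h1 : faces 𝒬 ⊆ ⋃ b ∈ (𝒬 : Set (Fin N → ℤ)), {F : Face N | F.IsFaceOf b} := by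
    intro F hF
    obtain ⟨b, hb, hFb⟩ := hF
    exact mem_biUnion hb hFb
  refine Set.Finite.subset (Set.Finite.biUnion 𝒬.finite_toSet fun b _ => ?_) h1
  refine (Set.finite_range (fun p : (Fin N → Bool) × Finset (Fin N) =>
    (⟨fun i => if p.1 i then b i + 1 else b i, p.2⟩ : Face N))).subset ?_
  intro F hF
  refine ⟨(fun i => decide (F.a i = b i + 1), F.S), ?_⟩
  ext i
  · dsimp only
    by_cases hc : F.a i = b i + 1
    · rw [if_pos (decide_eq_true hc), hc]
    · rw [if_neg (by simpa using hc)]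
      by_cases hi : i ∈ F.S
      · exact ((hF i).1 hi).symm
      · rcases (hF i).2 hi with h' | h'
        · exact h'.symm
        · exact absurd h' hc
  · rfl

variable (h : ℝ)

/-- The underlying set of the cube complex: the union of the top cubes of `𝒬`. [folklore] -/
def complex : Set (Fin N → ℝ) := ⋃ b ∈ 𝒬, (Face.top N b).carrier h

variable {𝒬 h}

/-- Membership in the complex. [folklore] -/
theorem mem_complex {x : Fin N → ℝ} : x ∈ complex 𝒬 h ↔ ∃ b ∈ 𝒬, x ∈ (Face.top N b).carrier h := by
  simp [complex]

/-- A face of a cube of `𝒬` lies in the complex. [folklore] -/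
theorem carrier_subset_complex (hh : 0 ≤ h) {F : Face N} (hF : F ∈ faces 𝒬) :
    F.carrier h ⊆ complex 𝒬 h := by
  obtain ⟨b, hb, hFb⟩ := hF
  intro x hx
  exact mem_complex.2 ⟨b, hb, Face.carrier_subset_carrier_top hh hFb hx⟩

/-- A top cube is compact: it is a closed sup-norm ball. [folklore] -/
theorem isCompact_carrier_top (b : Fin N → ℤ) :
    IsCompact ((Face.top N b).carrier h) := by
  have heq : (Face.top N b).carrier h =
      Set.pi univ fun i => Icc ((b i : ℝ) * h) (((b i : ℝ) + 1) * h) := by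
    ext x
    simp only [Face.mem_carrier_top, Set.mem_univ_pi, mem_Icc]
  rw [heq]
  exact isCompact_univ_pi fun i => isCompact_Icc

/-- A finite cube complex is compact. [folklore] -/
theorem isCompact_complex : IsCompact (complex 𝒬 h) :=
  𝒬.finite_toSet.isCompact_biUnion fun b _ => isCompact_carrier_top b

variable (𝒬) in
/-- The `n`-cells of the cube complex: faces of dimension `n` of cubes of `𝒬`. [folklore] -/
def Cell (n : ℕ) : Type := {F : Face N // F ∈ faces 𝒬 ∧ F.S.card = n}

/-- There are finitely many cells of each dimension. [folklore] -/
instance finite_cell (n : ℕ) : Finite (Cell 𝒬 n) :=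
  haveI : Finite (faces 𝒬) := (faces_finite 𝒬).to_subtype
  Finite.of_injective (fun c : Cell 𝒬 n => (⟨c.1, c.2.1⟩ : faces 𝒬))
    fun _ _ hcc' => Subtype.ext (congrArg Subtype.val hcc' :)

/-- There are no cells of dimension `> N`. [folklore] -/
theorem isEmpty_cell {n : ℕ} (hn : N < n) : IsEmpty (Cell 𝒬 n) :=
  ⟨fun c => by
    have h1 := c.2.2
    have h2 : c.1.S.card ≤ N := by
      simpa only [Fintype.card_fin] using Finset.card_le_univ c.1.S
    omega⟩

/-- The characteristic map of a cell, as a partial equivalence between the open unit cube and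
the relative interior of the face (inside the complex). [folklore] -/
def cellMap (hh : 0 < h) (n : ℕ) (c : Cell 𝒬 n) : PartialEquiv (Fin n → ℝ) ↥(complex 𝒬 h) where
  toFun y := ⟨c.1.param h c.2.2 y, carrier_subset_complex hh.le c.2.1 (Face.param_mem_carrier hh y)⟩
  invFun x := c.1.coord h c.2.2 x.1
  source := ball 0 1
  target := {x | x.1 ∈ c.1.relint h}
  map_source' := fun _ hy => Face.param_mem_relint hh hy
  map_target' := fun _ hx => Face.coord_mem_ball hh hx
  left_inv' := fun _ hy => Face.coord_param hh (ball_subset_closedBall hy)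
  right_inv' := fun _ hx => Subtype.ext (Face.param_coord hh (Face.relint_subset_carrier hx))

/-- The characteristic map of a cell is the characteristic map of its face. [folklore] -/
theorem cellMap_apply (hh : 0 < h) {n : ℕ} (c : Cell 𝒬 n) (y : Fin n → ℝ) :
    (cellMap hh n c y : Fin N → ℝ) = c.1.param h c.2.2 y := rfl

/-- The source of a characteristic map is the open unit cube. [folklore] -/
theorem cellMap_source (hh : 0 < h) {n : ℕ} (c : Cell 𝒬 n) : (cellMap hh n c).source = ball 0 1 :=
  rfl

/-- The closed cell of `c` is (the lift to the complex of) the closed face. [folklore] -/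
theorem mem_image_cellMap_closedBall (hh : 0 < h) {n : ℕ} (c : Cell 𝒬 n) {x : ↥(complex 𝒬 h)}
    (hx : (x : Fin N → ℝ) ∈ c.1.carrier h) : x ∈ cellMap hh n c '' closedBall 0 1 :=
  ⟨c.1.coord h c.2.2 x, Face.coord_mem_closedBall hh hx, Subtype.ext (Face.param_coord hh hx)⟩

variable (𝒬 h) in
/-- **A finite lattice cube complex is a finite CW complex**, the cells being the faces of its
cubes with their affine characteristic maps (Hatcher 2002, Appendix: the evident CW structure
on a union of cubes). [folklore] -/
@[reducible]
def cwComplex (hh : 0 < h) : CWComplex (univ : Set ↥(complex 𝒬 h)) :=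
  CWComplex.mkFinite (univ : Set ↥(complex 𝒬 h)) (Cell 𝒬) (cellMap hh)
    (eventually_isEmpty_cell := Filter.eventually_atTop.2 ⟨N + 1, fun n hn => isEmpty_cell (by omega)⟩)
    (finite_cell := fun n => finite_cell n)
    (source_eq := fun n c => rfl)
    (continuousOn := fun n c =>
      (Continuous.subtype_mk (Face.continuous_param) _).continuousOn)
    (continuousOn_symm := fun n c =>
      (Face.continuous_coord.comp continuous_subtype_val).continuousOn)
    (pairwiseDisjoint' := by
      rintro ⟨n, c⟩ - ⟨n', c'⟩ - hne
      refine Set.disjoint_left.2 fun x hx hx' => hne ?_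
      obtain ⟨y, hy, rfl⟩ := hx
      obtain ⟨y', hy', hyy'⟩ := hx'
      have h1 : c.1.param h c.2.2 y ∈ c.1.relint h := Face.param_mem_relint hh hy
      have h2 : c.1.param h c.2.2 y ∈ c'.1.relint h := by
        have h3 := congrArg Subtype.val hyy'
        rw [cellMap_apply, cellMap_apply] at h3
        rw [← h3]
        exact Face.param_mem_relint hh hy'
      have hcc : c.1 = c'.1 := Face.eq_of_mem_relint hh h1 h2
      obtain ⟨F, hF, hFn⟩ := c
      obtain ⟨F', hF', hFn'⟩ := c'
      dsimp only at hcc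
      subst hcc; subst hFn; subst hFn'
      rfl)
    (mapsTo_iff_image_subset := by
      rintro n ⟨F, hF, hFn⟩ y hy
      obtain ⟨j₀, hj₀⟩ := Face.exists_abs_eq_one_of_mem_sphere hy
      have hn : 1 ≤ n := by
        rcases Nat.eq_zero_or_pos n with rfl | h'
        · exact j₀.elim0
        · exact h'
      set i₀ : Fin N := (F.S.orderIsoOfFin hFn j₀ : Fin N) with hi₀
      have hi₀S : i₀ ∈ F.S := (F.S.orderIsoOfFin hFn j₀).2
      obtain ⟨b, hb, hFb⟩ := hF
      rcases hj₀ with hj | hj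
      · have hG : F.bdFace i₀ true ∈ faces 𝒬 := ⟨b, hb, Face.bdFace_isFaceOf hFb hi₀S true⟩
        have hGn : (F.bdFace i₀ true).S.card = n - 1 := by
          rw [Face.card_bdFace_S hi₀S, hFn]
        refine mem_iUnion.2 ⟨n - 1, mem_iUnion.2 ⟨by omega, mem_iUnion.2
          ⟨⟨F.bdFace i₀ true, hG, hGn⟩, mem_image_cellMap_closedBall hh _ ?_⟩⟩⟩
        exact Face.param_mem_carrier_bdFace_true hh hj
      · have hG : F.bdFace i₀ false ∈ faces 𝒬 := ⟨b, hb, Face.bdFace_isFaceOf hFb hi₀S false⟩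
        have hGn : (F.bdFace i₀ false).S.card = n - 1 := by
          rw [Face.card_bdFace_S hi₀S, hFn]
        refine mem_iUnion.2 ⟨n - 1, mem_iUnion.2 ⟨by omega, mem_iUnion.2
          ⟨⟨F.bdFace i₀ false, hG, hGn⟩, mem_image_cellMap_closedBall hh _ ?_⟩⟩⟩
        exact Face.param_mem_carrier_bdFace_false hh hj)
    (union' := by
      refine eq_univ_of_forall fun x => ?_
      obtain ⟨b, hb, hx⟩ := mem_complex.1 x.2
      have hc : Face.top N b ∈ faces 𝒬 ∧ (Face.top N b).S.card = N :=
        ⟨⟨b, hb, Face.top_isFaceOf b⟩, by simp⟩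
      exact mem_iUnion.2 ⟨N, mem_iUnion.2 ⟨⟨Face.top N b, hc⟩, mem_image_cellMap_closedBall hh _ hx⟩⟩)

/-- The CW structure of a finite cube complex is finite. [folklore] -/
theorem finite_cwComplex (hh : 0 < h) :
    letI := cwComplex 𝒬 h hh
    RelCWComplex.Finite (univ : Set ↥(complex 𝒬 h)) :=
  CWComplex.finite_mkFinite _ _ _ _ _ _ _ _ _ _ _

/-! ### Cubes of the lattice containing a given point; cubes meeting a bounded set -/

/-- Every point lies in the lattice cube of its coordinatewise integer parts. [folklore] -/
theorem mem_carrier_top_floor (hh : 0 < h) (x : Fin N → ℝ) :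
    x ∈ (Face.top N fun i => ⌊x i / h⌋).carrier h := by
  rw [Face.mem_carrier_top]
  intro i
  constructor
  · have h1 : ((⌊x i / h⌋ : ℤ) : ℝ) ≤ x i / h := Int.floor_le _
    rw [le_div_iff₀ hh] at h1
    exact h1
  · have h1 : x i / h < ((⌊x i / h⌋ : ℤ) : ℝ) + 1 := Int.lt_floor_add_one _
    rw [div_lt_iff₀ hh] at h1
    exact h1.le

/-- Two points of one lattice cube are at sup-distance `≤ h`. [folklore] -/
theorem dist_le_of_mem_carrier_top (hh : 0 ≤ h) {b : Fin N → ℤ} {x s : Fin N → ℝ}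
    (hx : x ∈ (Face.top N b).carrier h) (hs : s ∈ (Face.top N b).carrier h) : dist x s ≤ h := by
  rw [Face.mem_carrier_top] at hx hs
  rw [dist_pi_le_iff hh]
  intro i
  rw [Real.dist_eq, abs_le]
  constructor <;> nlinarith [hx i, hs i]

/-- Only finitely many lattice cubes meet a bounded set. [folklore] -/
theorem finite_setOf_carrier_top_inter_nonempty (hh : 0 < h) {S : Set (Fin N → ℝ)}
    (hS : Bornology.IsBounded S) :
    {b : Fin N → ℤ | ((Face.top N b).carrier h ∩ S).Nonempty}.Finite := by
  obtain ⟨R, hR⟩ := hS.subset_closedBall 0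
  set M : ℤ := ⌈R / h⌉ + 1 with hM
  refine (Set.Finite.pi (t := fun _ : Fin N => Set.Icc (-M) M) fun _ => Set.finite_Icc _ _).subset ?_
  rintro b ⟨x, hxb, hxS⟩
  rw [Set.mem_univ_pi]
  intro i
  have hxR : |x i| ≤ R := by
    have h1 := hR hxS
    rw [mem_closedBall_zero_iff] at h1
    exact (norm_le_pi_norm x i).trans h1
  rw [abs_le] at hxR
  rw [Face.mem_carrier_top] at hxb
  have hb := hxb i
  have hRh : R / h ≤ ⌈R / h⌉ := Int.le_ceil _
  have hRh' : R ≤ (⌈R / h⌉ : ℝ) * h := by rwa [div_le_iff₀ hh] at hRh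
  rw [mem_Icc, hM]
  constructor
  · have h1 : (-(⌈R / h⌉ + 1 + 1) : ℝ) * h < (b i : ℝ) * h := by nlinarith
    have h2 : (-(⌈R / h⌉ + 1 + 1 : ℤ) : ℝ) < b i := by
      have := lt_of_mul_lt_mul_right h1 hh.le
      exact_mod_cast this
    have h3 : -(⌈R / h⌉ + 1 + 1) < b i := by exact_mod_cast h2
    omega
  · have h1 : (b i : ℝ) * h < ((⌈R / h⌉ : ℝ) + 1) * h := by nlinarith
    have h2 : (b i : ℝ) < ⌈R / h⌉ + 1 := lt_of_mul_lt_mul_right h1 hh.le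
    have h3 : b i < ⌈R / h⌉ + 1 := by exact_mod_cast h2
    omega

end LatticeCube

/-! ### Cubical neighbourhoods -/

open LatticeCube in
/-- **Compact subsets of open sets in `ℝᴺ` have compact neighbourhoods which are finite CW
complexes.** For `S ⊆ O ⊆ ℝᴺ = Fin N → ℝ` with `S` compact and `O` open there is a compact `K`
with `S ⊆ K ⊆ O` such that `↥K` carries a finite classical CW structure
(`Topology.CWComplex (univ : Set ↥K)`): the union of the cubes of the lattice `h ℤᴺ` meeting
`S`, for a mesh `h` smaller than the distance from `S` to the complement of `O` (Hatcher 2002,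
Appendix, proof of Thm. A.7 / Cor. A.12: cubical neighbourhoods; CW structure
`LatticeCube.cwComplex`). [cite: HatcherAT2002, Appendix, Prop. A.11–Cor. A.12] -/
theorem exists_cwComplex_nbhd_of_isCompact {N : ℕ} {S O : Set (Fin N → ℝ)} (hS : IsCompact S)
    (hO : IsOpen O) (hSO : S ⊆ O) :
    ∃ (K : Set (Fin N → ℝ)) (_ : CWComplex (univ : Set ↥K)),
      RelCWComplex.Finite (univ : Set ↥K) ∧ IsCompact K ∧ S ⊆ K ∧ K ⊆ O := by
  obtain ⟨δ, hδ, hδO⟩ := hS.exists_cthickening_subset_open hO hSO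
  have hfin := finite_setOf_carrier_top_inter_nonempty hδ hS.isBounded
  set 𝒬 : Finset (Fin N → ℤ) := hfin.toFinset with h𝒬
  refine ⟨complex 𝒬 δ, cwComplex 𝒬 δ hδ, finite_cwComplex hδ, isCompact_complex, ?_, ?_⟩
  · intro x hx
    refine mem_complex.2 ⟨fun i => ⌊x i / δ⌋, ?_, mem_carrier_top_floor hδ x⟩
    rw [h𝒬, Set.Finite.mem_toFinset]
    exact ⟨x, mem_carrier_top_floor hδ x, hx⟩
  · intro x hx
    obtain ⟨b, hb, hxb⟩ := mem_complex.1 hx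
    rw [h𝒬, Set.Finite.mem_toFinset] at hb
    obtain ⟨s, hsb, hsS⟩ := hb
    exact hδO (mem_cthickening_of_dist_le x s δ S hsS (dist_le_of_mem_carrier_top hδ.le hxb hsb))

end Literature.Topology.Euclidean

end
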